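import Literature.NumberTheory.GaloisRepresentations.LocalKummerIota
import HarnessLib

/-!
# `Br(E)[n]` is split by the unramified extension of degree `n` (Serre, *Corps locaux* XIII §3)

Topic `NumberTheory/GaloisRepresentations`; namespace `Literature.NumberTheory.GaloisRepresentations`.
Theorems only (no definition, no named fact; D-0026).

Let `F` be a non-archimedean local field of characteristic `0`, `E ⊆ F̄` finite over `F` with
absolute Galois group `Γ_E = Gal(F̄/E)` (`galFixing F E ≤ Γ_F`), residue degree `f_E`
(`fDeg F E`), and for `m ≥ 1` let `E_m = E F_m` (`unrLevel F E m`) be the compositum with the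
unramified level `F_m` of `F`; for `f_E ∣ m` this is the unramified extension of `E` of degree
`m / f_E`.

* `resSub_unrLevel_eq_zero_of_nsmul_eq_zero` — **a class `b ∈ Br(E) = H²(Γ_E, F̄ˣ)` with
  `n b = 0` dies in `Br(E_{n f_E})`**, the unramified extension of degree `n` of `E`
  (Serre XIII §3: `Br(E) = ⋃ₙ Br(E_n/E)` with `Br(E_n/E)` cyclic of order `n`; equivalently
  `inv_E` is injective with `inv(Br(E_n/E)) = (1/n)ℤ/ℤ`).
* `resSub_unrLevel_two_mu_eq_zero` — **every class of `H²(Γ_E, μ_n)` dies in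
  `H²(Γ_{E_{n f_E}}, μ_n)`** (Kummer: `H²(Γ, μ_n) ↪ Br` over `E_{n f_E}` by Hilbert 90).

These are the inputs "the `p`-part of the Brauer group dies in the unramified tower" of the
computation `cd_p(Gal(F̄/F^nr)) ≤ 1`, hence of `cd_p(Γ_F) ≤ 2` (`LocalFieldCdTwo`).

## Proof

As in `LocalBrauerCyclicity.exists_mem_zmultiples_pair`: `b` dies on `Γ_{L₀}` for a finite Galois
`L₀/F` containing `E` and (enlarging) `E_{n f_E}`; in the frame `L₁ = L₀ F_m`, `m = [L₀ : E] f_E`,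
the relative group `Br(L₀/E)` is cyclic of order `N = [L₀ : E]` (`exists_resKer_eq_zmultiples`), and
so is `Br(E_{n f_E}/E) ⊆ Br(L₀/E)`, of order `n` (same theorem for the unramified layer, whose
index is `n` by `natCard_quot_unrLayer`).  In a cyclic group of order `N` the elements killed by `n`
form the subgroup generated by any element of order `n` (`mem_zmultiples_of_addOrderOf_eq`), so
`b ∈ Br(E_{n f_E}/E)`.

## References
* J.-P. Serre, *Corps locaux*, Hermann, 1968, XIII §3 Prop. 6–7 and Cor. 1–3. [SerreLocalFields1979]
* J.-P. Serre, *Galois Cohomology*, Springer, 1997, II §5.1–5.2. [SerreGaloisCohomology1997]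
-/

noncomputable section

open CategoryTheory Function
open Field IsNonarchimedeanLocalField ValuativeRel IntermediateField

universe u

namespace Literature.NumberTheory.GaloisRepresentations

open _root_.TopRep _root_.ContRepresentation _root_.ContinuousCohomology DiscreteGaloisModule
open _root_.Topology _root_.Filter
open LocalWeilDatum

/-! ### Cyclic groups: elements killed by `n` lie in the subgroup generated by an element of order `n` -/

/-- **In the cyclic group `⟨u⟩` of order `N`, an element `b` with `n b = 0` lies in `⟨u'⟩` for any
`u' ∈ ⟨u⟩` of order `n`** (Bezout). [folklore] -/
theorem mem_zmultiples_of_addOrderOf_eq {H : Type*} [AddCommGroup H] {u u' b : H} {N n : ℕ}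
    (hu : addOrderOf u = N) (hu' : u' ∈ AddSubgroup.zmultiples u)
    (hn : addOrderOf u' = n) (hn0 : 0 < n) (hb : b ∈ AddSubgroup.zmultiples u) (hnb : n • b = 0) :
    b ∈ AddSubgroup.zmultiples u' := by
  obtain ⟨j, rfl⟩ := AddSubgroup.mem_zmultiples_iff.1 hu'
  obtain ⟨i, rfl⟩ := AddSubgroup.mem_zmultiples_iff.1 hb
  -- `g = gcd(N, j)`
  set g : ℕ := Int.gcd (N : ℤ) j with hg
  have hgN : (g : ℤ) ∣ (N : ℤ) := Int.gcd_dvd_left _ _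
  have hgj : (g : ℤ) ∣ j := Int.gcd_dvd_right _ _
  have hNu : (N : ℤ) • u = 0 := by
    rw [natCast_zsmul, ← hu, addOrderOf_nsmul_eq_zero]
  -- `(N/g) u' = 0`, hence `n ∣ N/g`
  obtain ⟨j', hj'⟩ := hgj
  have h1 : ((N : ℤ) / g) • (j • u) = 0 := by
    rw [smul_smul, hj', ← mul_assoc, Int.ediv_mul_cancel hgN, mul_comm, mul_smul, hNu, smul_zero]
  have h2 : (n : ℤ) ∣ (N : ℤ) / g := by
    rw [← hn]
    exact addOrderOf_dvd_iff_zsmul_eq_zero.2 h1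
  -- `N ∣ n i`
  have h3 : (N : ℤ) ∣ n * i := by
    rw [← hu]
    refine addOrderOf_dvd_iff_zsmul_eq_zero.2 ?_
    rw [mul_smul, natCast_zsmul]
    exact hnb
  -- hence `g ∣ i`
  have h4 : (g : ℤ) ∣ i := by
    obtain ⟨t, ht⟩ := h2
    have hN' : (N : ℤ) = n * (t * g) := by
      rw [← mul_assoc, ← ht, Int.ediv_mul_cancel hgN]
    rw [hN'] at h3
    have hn0' : (n : ℤ) ≠ 0 := by exact_mod_cast hn0.ne'
    exact (dvd_mul_left (g : ℤ) t).trans (Int.dvd_of_mul_dvd_mul_left hn0' h3)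
  obtain ⟨i', rfl⟩ := h4
  -- Bezout: `g u = gcdB • (j u)`
  have hbez : ((g : ℤ)) • u = Int.gcdB (N : ℤ) j • (j • u) := by
    calc ((g : ℤ)) • u = ((N : ℤ) * Int.gcdA (N : ℤ) j + j * Int.gcdB (N : ℤ) j) • u := by
          rw [hg, Int.gcd_eq_gcd_ab (N : ℤ) j]
      _ = Int.gcdA (N : ℤ) j • ((N : ℤ) • u) + Int.gcdB (N : ℤ) j • (j • u) := by
          rw [add_smul, mul_comm (N : ℤ), mul_smul, mul_comm j, mul_smul]
      _ = Int.gcdB (N : ℤ) j • (j • u) := by rw [hNu, smul_zero, zero_add]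
  refine AddSubgroup.mem_zmultiples_iff.2 ⟨i' * Int.gcdB (N : ℤ) j, ?_⟩
  rw [mul_smul, ← hbez, smul_smul, mul_comm]

section Local

variable (F : Type u) [Field F] [ValuativeRel F] [TopologicalSpace F] [IsNonarchimedeanLocalField F]
  [CharZero F]

attribute [local instance] compactSpace_of_isClosed_subgroup isClosed_layerN isClosed_galFixing'

/-! ### `Br(E)[n]` dies in the unramified extension of degree `n` -/

/-- **A class of `Br(E) = H²(Gal(F̄/E), F̄ˣ)` killed by `n ≥ 1` restricts to zero on
`Gal(F̄/E_{n f_E})`**, `E_{n f_E} = E F_{n f_E}` the unramified extension of degree `n` of the finite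
extension `E` of the non-archimedean local field `F` of characteristic `0`.
[cite: SerreLocalFields1979, XIII §3 Prop. 7 and Cor. 1–3] -/
theorem resSub_unrLevel_eq_zero_of_nsmul_eq_zero (E : IntermediateField F (AlgebraicClosure F))
    [FiniteDimensional F E] {n : ℕ} (hn : 0 < n)
    (b : continuousCohomology 2 ((units F).restrict (subgroupIncl (galFixing F E))).toTopRep)
    (hb : n • b = 0) :
    resSub (units F) (galFixing_antitone F (le_unrLevel F E (n * fDeg F E))) 2 b = 0 := by
  classical
  -- the unramified level `m₁ = n f_E`
  set m₁ : ℕ := n * fDeg F E with hm₁def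
  have hm₁ : 0 < m₁ := Nat.mul_pos hn (fDeg_pos F E)
  haveI := (unramifiedLevel_finite_abelian_unramified F hm₁).1
  haveI := (unramifiedLevel_finite_abelian_unramified F hm₁).2.1
  -- Step 1: a finite Galois `L₀ ⊇ E F_{m₁}` on whose group `b` dies
  obtain ⟨Vx, hVx, hx⟩ := exists_nhds_resH_two_eq_zero ((units F).restrict (subgroupIncl (galFixing F E))) b
  obtain ⟨Wx, hWx, hWVx⟩ := (mem_nhds_subtype _ (1 : galFixing F E) Vx).1 hVx
  obtain ⟨L₀', hfin', hgal', hL₀'⟩ := exists_finiteDimensional_isGalois_galFixing_subset (k := F)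
    (inter_mem hWx ((isOpen_galFixing F E).mem_nhds (galFixing F E).one_mem))
  haveI := hfin'
  haveI := hgal'
  have hL₀'S : galFixing F L₀' ≤ galFixing F E := fun σ hσ => (hL₀' hσ).2
  let L₀ : IntermediateField F (AlgebraicClosure F) := L₀' ⊔ unramifiedLevel F m₁
  haveI : FiniteDimensional F L₀ := IntermediateField.finiteDimensional_sup L₀' _
  haveI : IsGalois F L₀ := isGalois_iff.2 ⟨inferInstance, inferInstance⟩
  have hL₀L₀' : galFixing F L₀ ≤ galFixing F L₀' := galFixing_antitone F le_sup_left
  have hL₀S : galFixing F L₀ ≤ galFixing F E := hL₀L₀'.trans hL₀'S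
  have hEL₀ : E ≤ L₀ := le_of_galFixing_le F hL₀S
  have hmE : unramifiedLevel F m₁ ≤ L₀ := le_sup_right
  have hEmL₀ : unrLevel F E m₁ ≤ L₀ := sup_le hEL₀ hmE
  have hmap : ((galFixing F L₀').subgroupOf (galFixing F E)).map (galFixing F E).subtype = galFixing F L₀' :=
    Subgroup.map_subgroupOf_eq_of_le hL₀'S
  have hresb' : resSub (units F) hL₀'S 2 b = 0 := by
    rw [← resSub_eq_zero_congr (units F) hmap (map_subtype_le' _) hL₀'S, resSub_eq_zero_iff_resH_eq_zero]
    exact hx _ (fun s hs => hWVx (hL₀' hs).1)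
  have hresb : resSub (units F) hL₀S 2 b = 0 := by
    rw [← resSub_resSub (units F) hL₀L₀' hL₀'S 2 b, hresb', map_zero]
  -- Step 2: the frame `L₁ = L₀ F_m`, `m = [L₀ : E] f_E`
  obtain ⟨N, hNdef⟩ : ∃ N : ℕ, N = (galFixing F L₀).relIndex (galFixing F E) := ⟨_, rfl⟩
  have hN0 : N ≠ 0 := by
    intro h0
    have h1 := Subgroup.relIndex_mul_index hL₀S
    rw [← hNdef, h0, zero_mul] at h1
    have h2 : (galFixing F L₀).index ≠ 0 := by
      rw [← ker_resGal, Subgroup.index_ker]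
      exact Nat.card_pos.ne'
    exact h2 h1.symm
  obtain ⟨m, hmdef⟩ : ∃ m : ℕ, m = N * fDeg F E := ⟨_, rfl⟩
  have hm : 0 < m := hmdef ▸ Nat.mul_pos (Nat.pos_of_ne_zero hN0) (fDeg_pos F E)
  haveI := (unramifiedLevel_finite_abelian_unramified F hm).1
  haveI := (unramifiedLevel_finite_abelian_unramified F hm).2.1
  let L₁ : IntermediateField F (AlgebraicClosure F) := L₀ ⊔ unramifiedLevel F m
  haveI : FiniteDimensional F L₁ := IntermediateField.finiteDimensional_sup L₀ _
  haveI : IsGalois F L₁ := isGalois_iff.2 ⟨inferInstance, inferInstance⟩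
  have hEL₁ : E ≤ L₁ := hEL₀.trans le_sup_left
  have hmL : unramifiedLevel F m ≤ L₁ := le_sup_right
  have hm₁L : unramifiedLevel F m₁ ≤ L₁ := hmE.trans le_sup_left
  let D : Subgroup (L₁ ≃ₐ[F] L₁) := (galFixing F E).map (resGal L₁)
  let D_L : Subgroup (L₁ ≃ₐ[F] L₁) := (galFixing F L₀).map (resGal L₁)
  let D_u : Subgroup (L₁ ≃ₐ[F] L₁) := unrLayer F L₁ D m₁
  have hDE : layerN L₁ D = galFixing F E := by
    change ((galFixing F E).map (resGal L₁)).comap (resGal L₁) = galFixing F E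
    rw [Subgroup.comap_map_eq_self]
    rw [ker_resGal]
    exact galFixing_antitone F hEL₁
  have hDL' : layerN L₁ D_L = galFixing F L₀ := by
    change ((galFixing F L₀).map (resGal L₁)).comap (resGal L₁) = galFixing F L₀
    rw [Subgroup.comap_map_eq_self]
    rw [ker_resGal]
    exact galFixing_antitone F le_sup_left
  have hDL : D_L ≤ D := Subgroup.map_mono hL₀S
  haveI : (galFixing F L₀).Normal := normal_galFixing L₀
  haveI : D_L.Normal := Subgroup.Normal.map inferInstance _ (resGal_surjective L₁)
  have hnL : (D_L.subgroupOf D).Normal := inferInstance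
  have hfield : fieldOf F L₁ D = E := by
    apply eq_of_galFixing_eq F
    rw [← layerN_eq_galFixing, hDE]
  have hrel : D_L.relIndex D = N := by
    rw [hNdef, ← hDE, ← hDL']
    change _ = (D_L.comap (resGal L₁)).relIndex (D.comap (resGal L₁))
    rw [Subgroup.relIndex_comap, Subgroup.map_comap_eq_self_of_surjective (resGal_surjective L₁)]
  have hmK : m = D_L.relIndex D * fDeg F (fieldOf F L₁ D) := by
    rw [hrel, hfield, hmdef]
  -- Step 3: `Br(L₀/E) = ⟨u⟩` of order `N`
  obtain ⟨u, hker, hordu, -⟩ := exists_resKer_eq_zmultiples F hDL hnL hm hmL hmK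
  -- Step 4: the unramified layer `D_u = D ∩ U_{m₁}`: `Br(E_{m₁}/E) = ⟨u'⟩` of order `n`
  have hDu : D_u ≤ D := unrLayer_le F L₁ D m₁
  have hnu : (D_u.subgroupOf D).Normal := normal_unrLayer F L₁ D hm₁
  have hDu' : layerN L₁ D_u = galFixing F (unrLevel F E m₁) := by
    have h := layerN_unrLayer F L₁ D hm₁L
    rw [hfield] at h
    exact h
  have hfm₁ : fDeg F (fieldOf F L₁ D) ∣ m₁ := ⟨n, by rw [hfield, hm₁def, mul_comm]⟩
  have hrelu : D_u.relIndex D = n := by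
    haveI := normal_layerN'_subgroupOf L₁ hDu hnu
    have hcard := natCard_quot_unrLayer F L₁ D hm₁ hm₁L hfm₁
    rw [hfield, hm₁def, Nat.mul_div_cancel _ (fDeg_pos F E)] at hcard
    rw [← Subgroup.map_comap_eq_self_of_surjective (resGal_surjective L₁) D, ← Subgroup.relIndex_comap]
    change (layerS L₁ D D_u).index = n
    rw [Subgroup.index_eq_card]
    exact hcard
  have hm₁K : m₁ = D_u.relIndex D * fDeg F (fieldOf F L₁ D) := by
    rw [hrelu, hfield, hm₁def]
  obtain ⟨u', hkeru, hordu', -⟩ := exists_resKer_eq_zmultiples F hDu hnu hm₁ hm₁L hm₁K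
  rw [hrelu] at hordu'
  rw [hrel] at hordu
  -- Step 5: transport `b` into the frame
  set b' := resSub (units F) hDE.le 2 b with hb'def
  have hb'L : b' ∈ resKer (units F) (layerN'_le L₁ hDL) := by
    rw [mem_resKer, hb'def, resSub_resSub, resSub_eq_zero_congr (units F) hDL' _ hL₀S]
    exact hresb
  have hnb' : n • b' = 0 := by rw [hb'def, ← map_nsmul, hb, map_zero]
  -- `⟨u'⟩ = Br(E_{m₁}/E) ⊆ Br(L₀/E) = ⟨u⟩` since `Γ_{L₀} ≤ Γ_{E_{m₁}}`
  have hLu : D_L ≤ D_u := by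
    refine le_inf hDL ?_
    exact Subgroup.map_mono (galFixing_antitone F hmE)
  have hu'L : u' ∈ resKer (units F) (layerN'_le L₁ hDL) := by
    have hu'u : u' ∈ resKer (units F) (layerN'_le L₁ hDu) := by
      rw [hkeru]; exact AddSubgroup.mem_zmultiples u'
    rw [mem_resKer] at hu'u ⊢
    rw [← resSub_resSub (units F) (Subgroup.comap_mono hLu : layerN' L₁ D_L ≤ layerN' L₁ D_u)
      (layerN'_le L₁ hDu) 2 u', hu'u, map_zero]
  rw [hker] at hb'L hu'L
  -- cyclic-group arithmetic: `b' ∈ ⟨u'⟩ = Br(E_{m₁}/E)`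
  have hb'u : b' ∈ resKer (units F) (layerN'_le L₁ hDu) := by
    rw [hkeru]
    exact mem_zmultiples_of_addOrderOf_eq hordu hu'L hordu' hn hb'L hnb'
  -- Step 6: back to `galFixing F E`
  rw [mem_resKer, hb'def, resSub_resSub, resSub_eq_zero_congr (units F) hDu' _
    (galFixing_antitone F (le_unrLevel F E m₁))] at hb'u
  exact hb'u

/-- **Every class of `H²(Gal(F̄/E), μ_n)` dies on `Gal(F̄/E_{n f_E})`** (`n ≥ 1`, `E/F` finite,
`F` non-archimedean local of characteristic `0`): the class is killed by `n`
(`nsmul_two_mu_eq_zero`), its image in `Br(E)` dies in `E_{n f_E}`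
(`resSub_unrLevel_eq_zero_of_nsmul_eq_zero`), and `H²(·, μ_n) → Br` is injective over `E_{n f_E}`
(Kummer, Hilbert 90: `kummerTwo_injective`). [cite: SerreLocalFields1979, XIII §3 Cor. 3]
[cite: SerreGaloisCohomology1997, II §5.2] -/
theorem resSub_unrLevel_two_mu_eq_zero (E : IntermediateField F (AlgebraicClosure F))
    [FiniteDimensional F E] {n : ℕ} (hn : 0 < n)
    (x : continuousCohomology 2 ((mu F n).restrict (subgroupIncl (galFixing F E))).toTopRep) :
    resSub (mu F n) (galFixing_antitone F (le_unrLevel F E (n * fDeg F E))) 2 x = 0 := by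
  classical
  have hm₁ : 0 < n * fDeg F E := Nat.mul_pos hn (fDeg_pos F E)
  haveI : FiniteDimensional F (unrLevel F E (n * fDeg F E)) := finiteDimensional_unrLevel F E hm₁
  set h := galFixing_antitone F (le_unrLevel F E (n * fDeg F E)) with hhdef
  -- Kummer injectivity over `E_{n f_E}`
  have hinj := kummerTwo_injective F (galFixing F (unrLevel F E (n * fDeg F E))) hn
    (subsingleton_one_units_galFixing (unrLevel F E (n * fDeg F E)))
  refine (injective_iff_map_eq_zero _).1 hinj _ ?_
  -- naturality of the Kummer map with `res`
  have hnat : kummerTwo F (galFixing F (unrLevel F E (n * fDeg F E))) n (resSub (mu F n) h 2 x) =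
      resSub (units F) h 2 (kummerTwo F (galFixing F E) n x) := by
    obtain ⟨c, rfl⟩ := twoCocycleClass_surjective _ x
    rw [resSub, map_twoCocycleClass, kummerTwo, cohomologyMap_twoCocycleClass, kummerTwo,
      cohomologyMap_twoCocycleClass, resSub, map_twoCocycleClass]
    congr 1
  rw [hnat]
  exact resSub_unrLevel_eq_zero_of_nsmul_eq_zero F E hn _
    (by rw [← map_nsmul, nsmul_two_mu_eq_zero, map_zero])

end Local

end Literature.NumberTheory.GaloisRepresentations

end
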